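import Literature.AlgebraicGeometry.Frobenioids.DivisorMonoidBirationalPerfectProofs
import HarnessLib

/-!
# Frobenioids I, Proposition 4.4 (iv): base-identity endomorphisms of `C^birat` are the classes of
# base-equivalent pairs `(α, φ)`

Mochizuki, *The geometry of Frobenioids I: the general theory*, Kyushu J. Math. **62** (2008)
293–400, §4, Proposition 4.4 (iv), kurims text p. 83 [cite: MochizukiFrdI2008, Prop. 4.4 (iv) p.83]:
"A morphism of `C^birat` is a base-identity endomorphism if and only if [it] arises from a pair
`(α : A′ → A; φ : A′ → A)`, where `α` is a co-angular pre-step in the indexing category of the inductive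
limit defining `Hom^birat_C(A, A)`, and `α` and `φ` are base-equivalent" ("follows immediately from the
definitions", proof p. 84).

PROOF-ONLY piece (theorems only) over abc-iut-L6-t8's `Birat F hF hsq` / `Birat.toElemZero` and this seat's
fraction lemmas (`DivisorMonoidBirationalPerfectProofs.lean`): the class `[(α, φ)]` has
`Base([(α, φ)]) = Base(α)⁻¹ ≫ Base(φ)`, so it is a base-identity endomorphism iff `Base(φ) = Base(α)`; the
linear ones (the elements of `O^▷(A^birat)`) are those with, moreover, `deg_Fr(φ) = 1`. Carved as L11a of
abc-iut-L1-d6's sub-DAG S2 ([FrdI] Cor. 4.11 (ii), p. 93 ll.36–46, where base-identity endomorphisms of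
`A ∈ Ob(C^birat)` are analysed). Seat abc-iut-L6-t20 (abc-iut cell). No statement of the paper is
strengthened; nothing here concerns the disputed parts of IUT.
-/

namespace Literature.AlgebraicGeometry.Frobenioids

open CategoryTheory

universe w v v' u u'

namespace PreFrobenioid

namespace Birat

variable {D : Type u} [Category.{v} D] {Φ : Dᵒᵖ ⥤ CommMonCat.{w}}
  {C : Type u'} [Category.{v'} C] {F : C ⥤ ElemFrobenioid Φ}
  {hF : IsFrobenioid F} {hsq : HasBiratSquares F}

/-- **Prop. 4.4 (iv)**: the class `[(α, φ)]` of a fraction from `A` to `A` is a base-identity endomorphism of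
`A^birat` iff `α` and `φ` are base-equivalent (`Base([(α, φ)]) = Base(α)⁻¹ ≫ Base(φ)`).
[cite: MochizukiFrdI2008, Prop. 4.4 (iv) p.83] -/
theorem isBaseIdentity_homMk_iff {A : C} (f : BiratFrac F A A) :
    IsBaseIdentity (toElemZero hF hsq) (homMk f : (toBirat F hF hsq).obj A ⟶ (toBirat F hF hsq).obj A) ↔
      BaseEquivalent F f.den f.num := by
  haveI : IsIso (Base F f.den) := f.den_mem.2.2
  change BiratFrac.base f = 𝟙 (baseObj F A) ↔ Base F f.den = Base F f.num
  unfold BiratFrac.base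
  rw [IsIso.inv_comp_eq, Category.comp_id]
  exact ⟨fun h => h.symm, fun h => h.symm⟩

/-- **Prop. 4.4 (iv)**, as printed: an endomorphism of `A^birat` is a base-identity endomorphism iff it
arises from a pair `(α, φ)` with `α` a co-angular pre-step and `α`, `φ` base-equivalent.
[cite: MochizukiFrdI2008, Prop. 4.4 (iv) p.83] -/
theorem isBaseIdentity_iff_exists_baseEquivalent {A : C}
    (g : (toBirat F hF hsq).obj A ⟶ (toBirat F hF hsq).obj A) :
    IsBaseIdentity (toElemZero hF hsq) g ↔
      ∃ f : BiratFrac F A A, (homMk f : (toBirat F hF hsq).obj A ⟶ (toBirat F hF hsq).obj A) = g ∧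
        BaseEquivalent F f.den f.num := by
  constructor
  · intro hg
    obtain ⟨f, rfl⟩ := exists_homMk_eq g
    exact ⟨f, rfl, (isBaseIdentity_homMk_iff f).mp hg⟩
  · rintro ⟨f, rfl, hf⟩
    exact (isBaseIdentity_homMk_iff f).mpr hf

/-- The class `[(α, φ)]` is linear iff `φ` is (`deg_Fr([(α, φ)]) = deg_Fr(φ)`).
[cite: MochizukiFrdI2008, Prop. 4.4 (iv) p.83] -/
theorem isLinear_homMk_iff {A B : C} (f : BiratFrac F A B) :
    IsLinear (toElemZero hF hsq) (homMk f : (toBirat F hF hsq).obj A ⟶ (toBirat F hF hsq).obj B) ↔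
      IsLinear F f.num := Iff.rfl

/-- `O^▷(A^birat)`: an endomorphism of `A^birat` is a base-identity LINEAR endomorphism iff it is the class of a
pair `(α, φ)` with `α`, `φ` base-equivalent and `φ` linear — i.e. `φ` a pre-step base-equivalent to the
co-angular pre-step `α` (the description of the units `O^×(A^birat)` behind Prop. 4.4 (iii)).
[cite: MochizukiFrdI2008, Prop. 4.4 (iv) p.83] -/
theorem mem_endSubmonoid_iff_exists {A : C} (g : (toBirat F hF hsq).obj A ⟶ (toBirat F hF hsq).obj A) :
    (show End ((toBirat F hF hsq).obj A) from g) ∈ endSubmonoid (toElemZero hF hsq) ((toBirat F hF hsq).obj A) ↔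
      ∃ f : BiratFrac F A A, (homMk f : (toBirat F hF hsq).obj A ⟶ (toBirat F hF hsq).obj A) = g ∧
        BaseEquivalent F f.den f.num ∧ IsLinear F f.num := by
  constructor
  · rintro ⟨hb, hl⟩
    obtain ⟨f, rfl⟩ := exists_homMk_eq g
    exact ⟨f, rfl, (isBaseIdentity_homMk_iff f).mp hb, hl⟩
  · rintro ⟨f, rfl, hb, hl⟩
    exact ⟨(isBaseIdentity_homMk_iff f).mpr hb, hl⟩

end Birat

end PreFrobenioid

end Literature.AlgebraicGeometry.Frobenioids
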